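import Summits.KontsevichZagierPeriods.KontsevichZagierPeriods.Theorems.ReducedPeriodRing.Negative.OrderTrichotomy

/-!
# `ReducedPeriodRing` (stmt-KontsevichZagierPeriods-3929) — bounded invariants are multiples of `eval`

Negative knowledge for the crux, sharpening `Negative/DominatedCertificates.lean` from DOMINATION
to mere BOUNDEDNESS (the analogue, for the rules of the Kontsevich–Zagier calculus, of "a bounded
solution of Cauchy's functional equation is linear"). Let `Λ : KZ.FormalRep →+ A` be additive with
values in a real normed space, killing `KZ.relations`, and merely BOUNDED ON SMALL BODIES:
`‖Λ [K, 1]‖ ≤ B` for every compact `ℚ`-semialgebraic body `K` (integrand `1`, non-empty interior)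
of volume `≤ ε₀`, for one fixed `ε₀ > 0` and one constant `B`. Then

* `bounded_invariant_eq_zero_of_eval_eq_zero` — `Λ` vanishes on `ker eval`: for `eval c = 0`
  every multiple `N • c` is, modulo the moves, a difference of two bodies of volume `ε < ε₀`
  (lead c8's `exists_body_add_sub_body_mem_relations`), so `N ‖Λ c‖ ≤ 2B` for all `N`;
* `invariant_eq_ratCast_smul_of_ker`, `bounded_invariant_eq_eval_smul` — and
  `Λ c = eval c • Λ u` for every `c` and every `u` of value `1`: with `q` rational in
  `(eval c − ε₀/N, eval c)`, the class `N • (c − [pt, q])` has value in `(0, ε₀)`, hence IS a small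
  body modulo the moves (`exists_body_of_eval_pos`, Viu-Sos normal form), which bounds
  `N ‖Λ c − eval c • Λ u‖ ≤ B + ε₀ ‖Λ u‖` for all `N`;
  real forms `bounded_invariant_eq_mul_eval` (`Λ = κ · eval`), `bounded_invariant_eq_eval`;
* `bounded_certificate_vanishes` — a bounded move-invariant functional vanishes on every
  square-zero candidate (`c * c ∈ relations`);
* `certificate_unbounded_on_small_bodies` — contrapositive: an additive certificate against the
  crux, or against Conjecture 1 (`φ` kills the relations, `φ c ≠ 0`, `eval c = 0`), is UNBOUNDED
  on the bodies of volume `≤ ε` for EVERY `ε > 0` — it is nowhere locally bounded in the volume.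

So among move-invariant additive functionals with values in a real normed space, `eval` is
characterised up to a vector constant by local boundedness alone; every refutation certificate is
a wildly discontinuous object. (Consistently, the Dirac-type slice functionals of
`Negative/SliceFunctional.lean` ARE bounded — by `1` on every body, their non-Dirac factors being
Lebesgue measure restricted to `[0, 1/2]` and `[0, 1]` — and are not multiples of `eval`, so they
cannot be move-invariant: indeed lead c2's subdivision relation has slice value `π/2`.) Values in
groups where `‖N • x‖` does not grow (e.g. `ℝ/ℤ`) are not covered and cannot be: there boundedness
is empty. Lead c9, `--supports stmt-KontsevichZagierPeriods-3929`; no definitions, no named facts.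
[Kontsevich–Zagier 2001, §1.2; Viu-Sos, IJNT 17 (2021), Thm. 1.1]
-/

noncomputable section

namespace Summit.KontsevichZagierPeriods.KontsevichZagierPeriods.ReducedPeriodRingNegative

open MeasureTheory Set
open Literature.NumberTheory.Transcendental KZ
open Summit.KontsevichZagierPeriods.KontsevichZagierPeriods.Theses.FurushoPentagon

variable {A : Type*} [NormedAddCommGroup A] [NormedSpace ℝ A]

/-! ### Bounded on small bodies ⇒ zero on `ker eval` -/

/-- **A move-invariant functional bounded on small bodies vanishes on `ker eval`.** If `Λ` kills
the relations and `‖Λ [K, 1]‖ ≤ B` for every compact body `K` of volume `≤ ε₀`, then `Λ c = 0`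
whenever `eval c = 0`: `N • c ∼ [E′, 1] − [E, 1]` with `vol E = vol E′ = ε < ε₀`
(`exists_body_add_sub_body_mem_relations`), so `N ‖Λ c‖ ≤ 2B` for every `N`.
[Viu-Sos, IJNT 17 (2021), Thm. 1.1] -/
theorem bounded_invariant_eq_zero_of_eval_eq_zero {Λ : FormalRep →+ A} {ε₀ B : ℝ} (hε₀ : 0 < ε₀)
    (hΛ : ∀ c ∈ relations, Λ c = 0)
    (hbdd : ∀ (m : ℕ) (K : IntegralRep m), IsCompact K.domain → (interior K.domain).Nonempty →
      (∀ z ∈ K.domain, K.integrand z = 1) → K.value ≤ ε₀ → ‖Λ (of K)‖ ≤ B)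
    {c : FormalRep} (hc : eval c = 0) : Λ c = 0 := by
  by_contra hne
  have hδ : 0 < ‖Λ c‖ := norm_pos_iff.mpr hne
  obtain ⟨ε, hε0, hεlt⟩ := exists_rat_btwn hε₀
  have hε0' : (0 : ℚ) < ε := by exact_mod_cast hε0
  obtain ⟨N, hN⟩ := exists_nat_gt (2 * B / ‖Λ c‖)
  have hNc : eval (N • c) = 0 := by rw [map_nsmul, hc, smul_zero]
  obtain ⟨m, E, m', E', hEc, hEi, hE1, hE'c, hE'i, hE'1, hEv, hE'v, hrel⟩ :=
    exists_body_add_sub_body_mem_relations hNc hε0'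
  have h0 : Λ (N • c + of E - of E') = 0 := hΛ _ hrel
  rw [map_sub, map_add, sub_eq_zero] at h0
  have hcE : Λ (N • c) = Λ (of E') - Λ (of E) := eq_sub_of_add_eq h0
  have h1 : ‖Λ (N • c)‖ ≤ B + B := by
    rw [hcE]
    refine (norm_sub_le _ _).trans (add_le_add ?_ ?_)
    · exact hbdd m' E' hE'c hE'i hE'1 (by rw [hE'v]; exact hεlt.le)
    · exact hbdd m E hEc hEi hE1 (by rw [hEv]; exact hεlt.le)
  have h2 : ‖Λ (N • c)‖ = (N : ℝ) * ‖Λ c‖ := by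
    rw [map_nsmul, ← Nat.cast_smul_eq_nsmul ℝ, norm_smul, Real.norm_natCast]
  have h3 : 2 * B < (N : ℝ) * ‖Λ c‖ := (div_lt_iff₀ hδ).mp hN
  linarith

/-- **Bounded certificates vanish on every candidate**: `c * c ∈ relations` forces `eval c = 0`,
so every move-invariant functional bounded on small bodies kills `c`. Companion of
`multiplicative_certificate_vanishes`, `bounded_exponent_certificate_vanishes`
(`Negative/Certificates.lean`) and of `dominated_certificate_vanishes`
(`Negative/DominatedCertificates.lean`). [folklore] -/
theorem bounded_certificate_vanishes {Λ : FormalRep →+ A} {ε₀ B : ℝ} (hε₀ : 0 < ε₀)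
    (hΛ : ∀ c ∈ relations, Λ c = 0)
    (hbdd : ∀ (m : ℕ) (K : IntegralRep m), IsCompact K.domain → (interior K.domain).Nonempty →
      (∀ z ∈ K.domain, K.integrand z = 1) → K.value ≤ ε₀ → ‖Λ (of K)‖ ≤ B)
    {c : FormalRep} (hc : c * c ∈ relations) : Λ c = 0 := by
  refine bounded_invariant_eq_zero_of_eval_eq_zero hε₀ hΛ hbdd ?_
  have h0 : eval (c * c) = 0 := relations_le_ker_eval_holds hc
  rw [eval_mul'] at h0
  exact mul_self_eq_zero.mp h0

/-- **Certificates are unbounded on arbitrarily small bodies.** If an additive `φ` with values in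
a real normed space kills the relations but `φ c ≠ 0` for some `c` of value `0` (a certificate
against Conjecture 1 — in particular one against the crux, `c * c ∈ relations`), then for every
`ε > 0` and every bound `B` some compact `ℚ`-semialgebraic body `K` of volume `≤ ε` has
`‖φ [K, 1]‖ > B`. [folklore] -/
theorem certificate_unbounded_on_small_bodies {φ : FormalRep →+ A}
    (hφ : ∀ c ∈ relations, φ c = 0) {c : FormalRep} (hc : eval c = 0) (hne : φ c ≠ 0)
    {ε : ℝ} (hε : 0 < ε) (B : ℝ) :
    ∃ (m : ℕ) (K : IntegralRep m), IsCompact K.domain ∧ (interior K.domain).Nonempty ∧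
      (∀ z ∈ K.domain, K.integrand z = 1) ∧ K.value ≤ ε ∧ B < ‖φ (of K)‖ := by
  by_contra h
  push Not at h
  exact hne (bounded_invariant_eq_zero_of_eval_eq_zero hε hφ
    (fun m K hKc hKi hK1 hKv => h m K hKc hKi hK1 hKv) hc)

/-! ### Bounded on small bodies ⇒ `eval(·) • Λ u` -/

/-- **Rational calibration through `ker eval`** (vector-valued). If an additive `Λ` vanishes on
`ker eval`, a class of rational value `q` takes the value `q • Λ u` for any `u` of value `1`
(`den(q) • d − num(q) • u ∈ ker eval`). [folklore] -/
theorem invariant_eq_ratCast_smul_of_ker {Λ : FormalRep →+ A}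
    (hker : ∀ c : FormalRep, eval c = 0 → Λ c = 0)
    {u : FormalRep} (hu : eval u = 1) {d : FormalRep} {q : ℚ} (hd : eval d = q) :
    Λ d = (q : ℝ) • Λ u := by
  have hqr : (q : ℝ) * (q.den : ℝ) = (q.num : ℝ) := by exact_mod_cast Rat.mul_den_eq_num q
  have hx : eval ((q.den : ℤ) • d - q.num • u) = 0 := by
    rw [map_sub, map_zsmul, map_zsmul, hd, hu, zsmul_eq_mul, zsmul_eq_mul, mul_one, sub_eq_zero,
      mul_comm]
    exact_mod_cast hqr
  have h0 := hker _ hx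
  rw [map_sub, map_zsmul, map_zsmul, sub_eq_zero] at h0
  have h1 : (q.den : ℝ) • Λ d = (q.num : ℝ) • Λ u := by
    have h0' : ((q.den : ℤ) : ℝ) • Λ d = ((q.num : ℤ) : ℝ) • Λ u := by
      rw [Int.cast_smul_eq_zsmul, Int.cast_smul_eq_zsmul]
      exact h0
    simpa only [Int.cast_natCast] using h0'
  have hden : (q.den : ℝ) ≠ 0 := Nat.cast_ne_zero.mpr q.den_nz
  calc Λ d = (q.den : ℝ)⁻¹ • ((q.den : ℝ) • Λ d) := by
        rw [smul_smul, inv_mul_cancel₀ hden, one_smul]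
    _ = (q.den : ℝ)⁻¹ • ((q.num : ℝ) • Λ u) := by rw [h1]
    _ = (q : ℝ) • Λ u := by rw [smul_smul, Rat.cast_def, div_eq_inv_mul]

/-- **`eval` is the only invariant bounded on small bodies, up to a vector constant.** If
`Λ : FormalRep →+ A` kills `KZ.relations` and `‖Λ [K, 1]‖ ≤ B` on compact bodies of volume
`≤ ε₀`, then `Λ c = eval c • Λ u` for every `c` and every `u` of value `1`. Proof: for `N ≥ 1`
and `q` rational in `(eval c − ε₀/N, eval c)`, the class `N • (c − [pt, q])` has value
`N (eval c − q) ∈ (0, ε₀)`, so it is ONE small body modulo the moves and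
`N ‖Λ c − eval c • Λ u‖ ≤ B + ε₀ ‖Λ u‖`. [Viu-Sos, IJNT 17 (2021), Thm. 1.1] -/
theorem bounded_invariant_eq_eval_smul {Λ : FormalRep →+ A} {ε₀ B : ℝ} (hε₀ : 0 < ε₀)
    (hΛ : ∀ c ∈ relations, Λ c = 0)
    (hbdd : ∀ (m : ℕ) (K : IntegralRep m), IsCompact K.domain → (interior K.domain).Nonempty →
      (∀ z ∈ K.domain, K.integrand z = 1) → K.value ≤ ε₀ → ‖Λ (of K)‖ ≤ B)
    {u : FormalRep} (hu : eval u = 1) (c : FormalRep) : Λ c = eval c • Λ u := by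
  have hker : ∀ c : FormalRep, eval c = 0 → Λ c = 0 :=
    fun c hc => bounded_invariant_eq_zero_of_eval_eq_zero hε₀ hΛ hbdd hc
  by_contra hne
  set t : ℝ := eval c with ht
  set x : A := Λ c - t • Λ u with hx
  have hx0 : 0 < ‖x‖ := norm_pos_iff.mpr (sub_ne_zero.mpr hne)
  -- a large multiplier `N`
  obtain ⟨N₀, hN₀⟩ := exists_nat_gt ((B + ε₀ * ‖Λ u‖) / ‖x‖)
  set N : ℕ := N₀ + 1 with hN
  have hNpos : (0 : ℝ) < N := by rw [hN]; positivity
  have hNgt : (B + ε₀ * ‖Λ u‖) / ‖x‖ < N := by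
    refine hN₀.trans ?_
    rw [hN]; push_cast; linarith
  have hNx : B + ε₀ * ‖Λ u‖ < (N : ℝ) * ‖x‖ := by
    have := (div_lt_iff₀ hx0).mp hNgt
    linarith
  -- a rational `q` with `0 < N (t − q) < ε₀`
  obtain ⟨q, hq1, hq2⟩ := exists_rat_btwn (sub_lt_self t (div_pos hε₀ hNpos))
  have htq : 0 < t - q := sub_pos.mpr hq2
  have htqN : (N : ℝ) * (t - q) < ε₀ := by
    have h1 : t - q < ε₀ / N := by linarith
    rwa [lt_div_iff₀ hNpos, mul_comm] at h1
  obtain ⟨r, hr⟩ := exists_eval_of_eq_ratCast q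
  -- the class `d = N • (c − [pt, q])` is one small body modulo the moves
  set d : FormalRep := N • (c - of r) with hd
  have hdv : eval d = (N : ℝ) * (t - q) := by
    rw [hd, map_nsmul, map_sub, hr, nsmul_eq_mul]
  have hdpos : 0 < eval d := by rw [hdv]; positivity
  obtain ⟨m, K, hKc, hKi, hK1, hK⟩ := exists_body_of_eval_pos hdpos
  have hKv : K.value = (N : ℝ) * (t - q) := by
    have h1 : eval (d - of K) = 0 := relations_le_ker_eval_holds hK
    rw [map_sub, sub_eq_zero, eval_of, hdv] at h1
    exact h1.symm
  have hΛd : Λ d = Λ (of K) := by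
    have h1 : Λ (d - of K) = 0 := hΛ _ hK
    rwa [map_sub, sub_eq_zero] at h1
  have hbd : ‖Λ d‖ ≤ B := by
    rw [hΛd]
    exact hbdd m K hKc hKi hK1 (by rw [hKv]; exact htqN.le)
  -- `Λ d = N • x + (N (t − q)) • Λ u`
  have hΛr : Λ (of r) = (q : ℝ) • Λ u := invariant_eq_ratCast_smul_of_ker hker hu hr
  have hdecomp : (N : ℝ) • x = Λ d - ((N : ℝ) * (t - q)) • Λ u := by
    rw [hd, map_nsmul, map_sub, hΛr, ← Nat.cast_smul_eq_nsmul ℝ, hx, mul_smul]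
    simp only [smul_sub, sub_smul]
    abel
  have hnorm : (N : ℝ) * ‖x‖ ≤ B + ε₀ * ‖Λ u‖ := by
    have h1 : ‖(N : ℝ) • x‖ = (N : ℝ) * ‖x‖ := by rw [norm_smul, Real.norm_natCast]
    rw [← h1, hdecomp]
    refine (norm_sub_le _ _).trans (add_le_add hbd ?_)
    rw [norm_smul, Real.norm_eq_abs, abs_of_pos (by positivity : (0 : ℝ) < N * (t - q))]
    exact mul_le_mul_of_nonneg_right htqN.le (norm_nonneg _)
  linarith

/-- **Real-valued form: `Λ = κ · eval`.** Every move-invariant additive functional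
`FormalRep →+ ℝ` bounded on the compact bodies of volume `≤ ε₀` is a real multiple of `eval`.
[Viu-Sos, IJNT 17 (2021), Thm. 1.1] -/
theorem bounded_invariant_eq_mul_eval {Λ : FormalRep →+ ℝ} {ε₀ B : ℝ} (hε₀ : 0 < ε₀)
    (hΛ : ∀ c ∈ relations, Λ c = 0)
    (hbdd : ∀ (m : ℕ) (K : IntegralRep m), IsCompact K.domain → (interior K.domain).Nonempty →
      (∀ z ∈ K.domain, K.integrand z = 1) → K.value ≤ ε₀ → |Λ (of K)| ≤ B) :
    ∃ κ : ℝ, ∀ c : FormalRep, Λ c = κ * eval c := by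
  obtain ⟨u, hu⟩ := exists_eval_of_eq_ratCast 1
  have hu1 : eval (of u) = 1 := by rw [hu, Rat.cast_one]
  refine ⟨Λ (of u), fun c => ?_⟩
  have h := bounded_invariant_eq_eval_smul (A := ℝ) hε₀ hΛ
    (fun m K hKc hKi hK1 hKv => by rw [Real.norm_eq_abs]; exact hbdd m K hKc hKi hK1 hKv) hu1 c
  rw [h, smul_eq_mul, mul_comm]

/-- **Uniqueness of the period functional among locally bounded functionals.** A move-invariant
additive functional `FormalRep →+ ℝ`, bounded on the compact bodies of volume `≤ ε₀` and
normalised by `Λ u = 1` on one class `u` of value `1`, IS the evaluation map.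
[Viu-Sos, IJNT 17 (2021), Thm. 1.1] -/
theorem bounded_invariant_eq_eval {Λ : FormalRep →+ ℝ} {ε₀ B : ℝ} (hε₀ : 0 < ε₀)
    (hΛ : ∀ c ∈ relations, Λ c = 0)
    (hbdd : ∀ (m : ℕ) (K : IntegralRep m), IsCompact K.domain → (interior K.domain).Nonempty →
      (∀ z ∈ K.domain, K.integrand z = 1) → K.value ≤ ε₀ → |Λ (of K)| ≤ B)
    {u : FormalRep} (hu : eval u = 1) (hΛu : Λ u = 1) : Λ = eval := by
  refine AddMonoidHom.ext fun c => ?_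
  have h := bounded_invariant_eq_eval_smul (A := ℝ) hε₀ hΛ
    (fun m K hKc hKi hK1 hKv => by rw [Real.norm_eq_abs]; exact hbdd m K hKc hKi hK1 hKv) hu c
  rw [h, hΛu, smul_eq_mul, mul_one]

end Summit.KontsevichZagierPeriods.KontsevichZagierPeriods.ReducedPeriodRingNegative
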